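import Mathlib
import HarnessLib
import HarnessLib.Audit
import Summits.AtomisticToContinuum.Statement
import Literature.MathematicalPhysics.KineticTheory.HarmonicChainFlux
import Literature.Barriers.AtomisticToContinuum.LowTemperatureWeakAnharmonicity
import Summits.AtomisticToContinuum.FouriersLaw.Theorems.FourierGreenKuboFourierFiniteResponseOfUnique

/-!
Route: KineticSlab

CLOSED (superseded) 2026-08-15T12:32:13Z by planner-plancard-AtomisticToContinuum-Fourier-3b36f0d1-0 — reason: superseded:route-AtomisticToContinuum-KineticSlabContacts — superseded by route-AtomisticToContinuum-KineticSlabContacts — note: STUB from an interrupted route open (gate restarts 12:16Z/12:25Z): the row was created 11:46Z but its items and Theses file were never written and re-open was refused; the identical route.json was opened as route-AtomisticToContinuum-KineticSlabContacts (10 items, file rev 0 commit 4b506e2). No item. The file is kept as the record of this route; refuted decls are indexed as negative knowledge (`ledger negatives`).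

# Route KineticSlab — Kinetic shadow of BLR — on the diagonal N = L·(λT)⁻² the per-bond conductance
Γ(L) runs from the proved RLL ballistic value to Ohm's law with a Milne contact resistance
(phonon-Boltzmann slab)

RUNG / REGIME route realising idea card kinetic-slab-with-contacts (and, as a by-product, Claim 4
'KineticWindowFourier' of card onset-of-resistance-secular-series, whose spine Claims 1–3 remain a
separate line). By the PROVED amplitude conjugacy
(Literature.Barriers.AtomisticToContinuum.LowTemperatureWeakAnharmonicity: D_N(T; lam, β) = D_N(1;
lamT, βT)) the conjunct's chain at temperature T is the chain P_ε := pinnedChain ω₂ (ε·a) (ε·b) γ at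
temperature 1 with ε = T, (a, b) = (lam, β); its kinetic mean free path is ≍ ε⁻². Write G_N(ε) :=
D_N(ε)/(N − 1) for the per-bond linear-response conductance of P_ε at T = 1 (BLR's own coefficient:
δ → 0 taken FIRST, at finite N) and go to the DIAGONAL N = ⌈L/ε²⌉. X_K (KINETIC FOURIER LAW WITH
CONTACTS): for all ω₂, a, b, γ > 0, under weak-NESS uniqueness (HasUniqueSteadyStates) and finite T
= 1 response for every P_ε (shared items 0741/0717 instantiated), (i) X_S: the diagonal limit Γ(L)
:= lim_{ε→0⁺} G_{⌈L/ε²⌉}(ε) exists and is positive for every kinetic length L > 0 [crux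
KineticSlabLimit]; (ii) Γ(0⁺) = fluxLimit ω₂ γ, the Rieder–Lebowitz–Lieb/Nakazawa ballistic constant
c_∞ PROVED in the tree [from crux SubkineticBallisticWindow]; (iii) X_M, OHM'S LAW WITH A CONTACT
RESISTANCE: 1/Γ(L) − L/c → ρ as L → ∞ with c > 0 (kinetic conductivity, = lim ε²κ) and ρ > 0 (the
two walls' Milne extrapolation lengths over c) [crux MilneContactLaw]. Informally Γ(L) is the
two-wall conductance of the stationary linearised phonon-Boltzmann SLAB v(k)∂_yW = C_lin W on (0, L)
× 𝕋 with the Kirchhoff/albedo wall law α_γ(k) of a Langevin END site (support LandauerAlbedoIdentity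
ties α_γ to the proved fluxLimit), C_lin = the Aoki–Lukkarinen–Spohn number- and energy-conserving
2↔2 operator of the pinned band ω(k)² = ω₂ + 4 sin²(k/2) with quartic vertex a + b·Π_j(e^{ik_j} −
1). X_K is NOT FouriersLawFor (limits along the diagonal, ε → 0 before L → ∞); no implication to the
conjunct is claimed and the Assembly ends in the route-local target KineticFourierLaw.
Lean: `∀ ω₂ a b γ : ℝ, 0 < ω₂ → 0 < a → 0 < b → 0 < γ → (∀ ε : ℝ, 0 < ε →
(Literature.MathematicalPhysics.KineticTheory.HeatConduction.pinnedChain ω₂ (ε * a) (ε * b)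
γ).HasUniqueSteadyStates) → (∀ ε : ℝ, 0 < ε → ∀ μ : (N : ℕ) → ℝ → ℝ → MeasureTheory.Measure
(Literature.MathematicalPhysics.KineticTheory.HeatConduction.PhaseSpace N), (∀ (N : ℕ) (T_L T_R :
ℝ), 0 < T_L → 0 < T_R → (Literature.MathematicalPhysics.KineticTheory.HeatConduction.pinnedChain ω₂
(ε * a) (ε * b) γ).IsSteadyState N T_L T_R (μ N T_L T_R)) → ∀ N : ℕ, ∃ d : ℝ, Filter.Tendsto (fun δ
: ℝ => (Literature.MathematicalPhysics.KineticTheory.HeatConduction.pinnedChain ω₂ (ε * a) (ε * b)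
γ).totalCurrent (μ N (1 + δ / 2) (1 - δ / 2)) / δ) (nhdsWithin 0 {(0 : ℝ)}ᶜ) (nhds (d))) → ∃ (Γ : ℝ
→ ℝ) (c ρ : ℝ), 0 < c ∧ 0 < ρ ∧ (∀ L : ℝ, 0 < L → 0 < Γ L ∧ ∀ D : ℝ → ℕ → ℝ, (∀ ε : ℝ, 0 < ε → ∃ μ :
(N : ℕ) → ℝ → ℝ → MeasureTheory.Measure
(Literature.MathematicalPhysics.KineticTheory.HeatConduction.PhaseSpace N), (∀ (N : ℕ) (T_L T_R :
ℝ), 0 < T_L → 0 < T_R → (Literature.MathematicalPhysics.KineticTheory.HeatConduction.pinnedChain ω₂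
(ε * a) (ε * b) γ).IsSteadyState N T_L T_R (μ N T_L T_R)) ∧ ∀ N : ℕ, Filter.Tendsto (fun δ : ℝ =>
(Literature.MathematicalPhysics.KineticTheory.HeatConduction.pinnedChain ω₂ (ε * a) (ε * b)
γ).totalCurrent (μ N (1 + δ / 2) (1 - δ / 2)) / δ) (nhdsWithin 0 {(0 : ℝ)}ᶜ) (nhds (D ε N))) →
Filter.Tendsto (fun ε : ℝ => D ε ⌈L / ε ^ 2⌉₊ / (((⌈L / ε ^ 2⌉₊ : ℕ) : ℝ) - 1)) (nhdsWithin 0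
(Set.Ioi 0)) (nhds (Γ L))) ∧ Filter.Tendsto Γ (nhdsWithin 0 (Set.Ioi 0)) (nhds
(Literature.MathematicalPhysics.KineticTheory.HeatConduction.fluxLimit ω₂ γ)) ∧ Filter.Tendsto (fun
L : ℝ => 1 / Γ L - L / c) Filter.atTop (nhds ρ)`

## Assembly
Real analysis only (checked on paper against the typed statements; about 150 Lean lines): fix ω₂, a,
b, γ > 0, hEU, hF. KineticSlabLimit gives Γ with positivity and diagonal convergence for every L >
0; MilneContactLaw applied to this Γ (its hypothesis is KineticSlabLimit's conclusion minus
positivity) gives c, ρ and the Ohm clause. For the ballistic clause build ONE diagonal response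
function D by choice (family from hEU, coefficients from hF, so hypD holds) and use the sequential
criterion for the countably generated filter 𝓝[>]0: given L_n → 0⁺, for each n with L_n > 0 pick ε_n
> 0 with ε_n² < L_n/(n+1) and |D ε_n N_n/(N_n − 1) − Γ(L_n)| < 1/(n+1), N_n := ⌈L_n/ε_n²⌉ (both
conditions are eventual in the NeBot filter 𝓝[>]0); then N_n > n + 1 → ∞ and N_n·ε_n² ≤ L_n + ε_n² →
0, so SubkineticBallisticWindow gives D ε_n N_n/(N_n − 1) → fluxLimit ω₂ γ and hence Γ(L_n) →
fluxLimit ω₂ γ (finitely many n with L_n ≤ 0 are harmless).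

Rationale: WHY THIS LINE. The card's move is to carry BLR's actual geometry — two Langevin contacts, finite N,
δ → 0 first — into the only corner that has a small parameter (the barrier
LowTemperatureWeakAnharmonicity lists 'resummed expansions organised on the kinetic scale t ∼
(λT)⁻², N ∼ (λT)⁻²' as its evasion) and to read the whole ballistic-to-Fourier crossover off ONE
function Γ(L) of the kinetic length: the walls cut phonon trajectories after O(L) collisions, so no
post-kinetic tail is needed (contrast route KineticCorner: infinite-volume Green–Kubo with a
PostKineticTail crux), and the contacts become the subject — Milne extrapolation lengths = a
low-temperature contact resistance that stays finite and T-independent while κ and the mean free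
path diverge like (λT)⁻² (card predictions p1–p4). Imported areas, with the explicit dictionary
phonon Wigner function ↦ specific intensity, Langevin end ↦ grey wall of emissivity α_γ(k): linear
transport / radiative transfer in slab geometry (diffusion approximation and Milne half-space
problems BensoussanLionsPapanicolaou1979, BardosSantosSentis1984, LiLuSun2017, two-species Milne
AokiLinWu2020; the phonon-engineering 'equation of phonon radiative transfer' Majumdar1993),
stationary kinetic and hydrodynamic limits with reservoirs for gases (CaprinoPulvirenti1996,
EspositoLebowitzMarra1994, EspositoEtAl2013), and the kinetic theory of the point Langevin
thermostat (KomorowskiEtAl2020, KomorowskiOlla2020, BasileKomorowskiOlla2019) transplanted from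
harmonic to weakly anharmonic chains (AokiLukkarinenSpohn2006, Spohn2006Phonon,
LukkarinenSpohn2010). What no existing route does: a statement about the conjunct's own D_N in which
bulk (c) and contacts (ρ) are simultaneously O(1) and separately identified, anchored at the PROVED
harmonic constant fluxLimit (Literature.Barriers.AtomisticToContinuum.HarmonicChainBallisticFlux,
tendsto_fluxCoeff) at L → 0⁺; the negatives index is empty at filing.

RANKED CRUXES. #0 KineticFourierLaw (target) — X_K as in § Thesis: for ω₂, a, b, γ > 0, assuming
HasUniqueSteadyStates and finite T = 1 response for every P_ε (ε > 0), there are Γ : ℝ → ℝ, c > 0, ρ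
> 0 with: for every L > 0, Γ(L) > 0 and every diagonal response function D (D ε N = the T = 1
response coefficient of P_ε at length N, for some steady-state family) satisfies D ε ⌈L/ε²⌉/(⌈L/ε²⌉
− 1) → Γ(L) as ε → 0⁺; Γ(L) → fluxLimit ω₂ γ as L → 0⁺; and 1/Γ(L) − L/c → ρ as L → ∞. (why it might
fail: Inherits the cruxes: no stationary anharmonic kinetic limit exists in print
(KineticSlabLimit); grazing band-edge modes or an odd collisional invariant could spoil the affine
resistance law or c > 0 (MilneContactLaw); resistance could set in below the kinetic length
(SubkineticBallisticWindow).) [BonettoLebowitzReyBellet2000, AokiLukkarinenSpohn2006,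
KomorowskiOlla2020, BardosSantosSentis1984, RoyDhar2008]
#2 KineticSlabLimit (crux) — (card item KineticSlabLimit, existence half; the identification is its
informal content) for ω₂, a, b, γ > 0 and unique weak steady states of every P_ε there is Γ with,
for every L > 0: Γ(L) > 0 and, for every diagonal response function D, D ε ⌈L/ε²⌉/(⌈L/ε²⌉ − 1) →
Γ(L) as ε → 0⁺. Intended proof and meaning: on the diagonal the NESS Wigner function of P_ε
converges to the solution of the stationary linearised phonon-Boltzmann slab v(k)∂_yW = C_lin W on
(0, L) × 𝕋 with albedo wall conditions (a phonon hitting a Langevin end is absorbed with probability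
α_γ(k), reflected k ↦ −k otherwise; the wall emits at its bath temperature with emissivity α_γ(k)) —
the END-thermostat version of the Komorowski–Olla interface law — and Γ(L) is that slab's
conductance; C_lin = ALS's 2↔2 operator of the pinned band ω(k)² = ω₂ + 4 sin²(k/2) with quartic
vertex a + b·Π_j(e^{ik_j} − 1), conserving energy AND phonon number (δ = 1/(ω₂+2) < 1/2 for every ω₂
> 0). [difficulty: open-problem] (why it might fail: No stationary kinetic limit is proved for any
anharmonic lattice: needs NESS cumulant control uniformly in N ≍ ε⁻² (boundary-driven
Lukkarinen–Spohn/Deng–Hani expansion); LS2010 reach kinetic times < t₀ only and a phonon lives ~L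
kinetic units in the slab: large L may defeat convergent expansions.) [AokiLukkarinenSpohn2006,
Spohn2006Phonon, LukkarinenSpohn2010, KomorowskiOlla2020, KomorowskiEtAl2020, CaprinoPulvirenti1996,
DengHani2023, BricmontKupiainen2007]
#3 MilneContactLaw (crux) — (card items SlabDiffusionApproximation and TwoFluid, chain-side form)
for ω₂, a, b, γ > 0, unique weak steady states and finite T = 1 responses of every P_ε: every
function Γ that is the diagonal limit of the per-bond conductance (hypothesis copied from
KineticSlabLimit) obeys Ohm's law with a contact resistance: ∃ c > 0, ρ > 0 with 1/Γ(L) − L/c → ρ as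
L → ∞. Content: identification of Γ with the slab conductance, then the diffusion approximation of
the slab BVP with Milne boundary layers at the two grey walls. Because 3↔1 processes are
non-resonant for every ω₂ > 0 (HuveneersLukkarinen2020), ker C_lin ⊇ {1, ω} and the slab is a
TWO-FLUID conductor (energy + phonon number); the walls pin the phonon chemical potential to 0 and
the 2×2 Onsager algebra gives 1/Γ = L/𝕃_ee + (𝕃𝔹𝕃)_ee/𝕃_ee² + O(1/L) with 𝔹 the sum of the two Milne
jump matrices — so c = 𝕃_ee (the Green–Kubo energy coefficient: κ_BLR = L_ee, not the open-circuit
L_ee − L_en²/L_nn) and ρ = two extrapolation lengths over c. [deps: KineticSlabLimit] [difficulty: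
L] (why it might fail: Milne theory is printed for gapped one-speed operators; C_lin has unbounded
collision frequency, slow band-edge modes (v→0) and kernel {1,ω}: extrapolation lengths may diverge
or corrections be O(log L); c>0 needs NoOddCollisionalInvariant (ALS06 §4: no proof); ρ>0 needs a
two-fluid jump matrix ≥ 0.) [BardosSantosSentis1984, BensoussanLionsPapanicolaou1979, LiLuSun2017,
AokiLinWu2020, BasileKomorowskiOlla2019, HuveneersLukkarinen2020, AokiLukkarinenSpohn2006,
Majumdar1993, EspositoLebowitzMarra1994]
#4 SubkineticBallisticWindow (crux) — (card prediction p4 = the matching condition with card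
onset-of-resistance-secular-series) below the kinetic length the anharmonic chain conducts like the
harmonic one: for ω₂, a, b, γ > 0, unique weak steady states of every P_ε, every diagonal response
function D and all sequences ε_n → 0⁺, N_n → ∞ with N_n·ε_n² → 0: D ε_n N_n/(N_n − 1) → fluxLimit ω₂
γ = c_∞ (the RLL/Nakazawa ballistic constant, PROVED: tendsto_fluxCoeff, fluxLimit_pos). With
KineticSlabLimit it yields Γ(0⁺) = c_∞, the Landauer end of the slab; its expected sharpening G_N =
c_N(1 + O(ε) − σε²N + …) is the matching condition with the secular series of the onset card.
[difficulty: L] (why it might fail: Resistance might set in before the kinetic length: order-ε^k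
NESS corrections must be controlled uniformly for N ≪ ε⁻² against the N⁻³ gap of the open harmonic
chain (Becker–Menegaki) and an only-asymptotic (non-analytic at ε=0) coupling expansion;
Lefevere–Schenkel: order one only.) [LefevereSchenkel2004, BeckerMenegaki2022, RoyDhar2008,
Nakazawa1970, HairerMajda2009, AokiLukkarinenSpohn2006]
#9 LandauerAlbedoIdentity (support) — (card item EndThermostatAlbedo, its checkable core) the PROVED
RLL/Nakazawa constant is the incoherent two-grey-wall Landauer integral with the END-THERMOSTAT
ALBEDO: fluxLimit ω₂ γ = (1/2π)∫_0^π v(k)·α_γ(k)/(2 − α_γ(k)) dk with ω(k) = √(ω₂ + 2(1 − cos k)), v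
= sin k/ω, α_γ(k) = 1 − |ρ_γ(k)|² = 4γω sin k/((1 − cos k)² + (sin k + γω)²) the absorption
probability of a band phonon hitting the Langevin end site (impedance mismatch of the
Ornstein–Uhlenbeck end; α/(2 − α) = phase-averaged Fabry–Pérot transmission of two identical walls),
which simplifies to the typed closed form fluxLimit ω₂ γ = (γ/π)∫_0^π sin²k/(2(1+γ²)(1 − cos k) +
γ²ω₂) dk. Verified numerically to 1e−14 at six (ω₂, γ) by the planner; an elementary integral (∫_0^π
sin²k/(A − B cos k) dk = π(A − √(A² − B²))/B²) against rootR. [difficulty: provable-now]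
[RiederLebowitzLieb1967, Nakazawa1970, RoyDhar2008, Dhar2008, KomorowskiOlla2020]
#9 HarmonicLimitAtFixedLength (support) — (base case of SubkineticBallisticWindow at FIXED N;
calibrates the normalisation D_N = (N−1)c_N of HarmonicChainBallisticFlux.ballisticLaw) for ω₂, a,
b, γ > 0, unique weak steady states of every P_ε and every diagonal response function D: for each N
≥ 2, D ε N → (N − 1)·fluxCoeff ω₂ γ N as ε → 0⁺ (continuity of BLR's finite-N response at the
harmonic point). Fixed-N technology: tightness of the NESS of P_ε uniformly in ε ∈ (0, 1] (Lyapunov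
control à la Cuneo–Eckmann–Hairer–Rey-Bellet with ε-uniform constants — the one non-routine point,
since the quartic confinement degenerates), weak convergence to the unique Gaussian RLL state, and
convergence of the δ-derivative via the finite-N Kubo formula. [difficulty: M]
[CuneoEckmannHairerReyBellet2018, HairerMajda2009, ReyBellet2003, RoyDhar2008, LefevereSchenkel2004]
#9 NessUnique (support) — shared item stmt-AtomisticToContinuum-0741 (uniqueness of the weak steady
state of pinnedChain, all parameters > 0), re-wanted verbatim: with the proved existence
(pinnedChain_exists_isSteadyState) it is hypothesis hEU (HasUniqueSteadyStates of every P_ε) of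
every diagonal statement of this route. [difficulty: M] [CuneoEckmannHairerReyBellet2018,
BonettoLebowitzReyBellet2000]
#9 FiniteResponseOfUnique (support) — shared item stmt-AtomisticToContinuum-0717 (existence of BLR's
finite-N response limits under uniqueness), re-wanted verbatim: its T = 1 instance for P_ε is
hypothesis hF of MilneContactLaw and of the target, and makes 'diagonal response functions' exist.
[difficulty: M] [ReyBellet2003, HairerMajda2009]
#9 NoOddCollisionalInvariant (support) — shared item stmt-AtomisticToContinuum-3432 of route
KineticCorner, re-wanted verbatim: no odd continuous collisional invariant on the 2↔2 resonant set
of the pinned band — the input that makes the slab's energy current orthogonal to ker C_lin, i.e. 0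
< c < ∞ in MilneContactLaw (kinetic shadow of the Mazur barrier). [difficulty: L]
[AokiLukkarinenSpohn2006, Spohn2006, LukkarinenSpohn2008]

TWO-LAYER PLAN. Once the definitions land (§ Definition requests): MilneContactLaw ⇐
SlabIdentification → SlabMilneAsymptotics → MilneContactLaw (SlabIdentification: Γ = conductance of
the two-fluid phonon-Boltzmann slab with albedo walls; SlabMilneAsymptotics: pure linear transport —
well-posedness of the stationary slab BVP in the weighted L², diffusion approximation with two Milne
half-space problems, affine resistance with c = 𝕃_ee and ρ = (𝕃𝔹𝕃)_ee/𝕃_ee² > 0). KineticSlabLimit ⇐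
ShortSlabExpansion (∃ L₀: convergent collision/Duhamel expansion of the NESS on the diagonal for L <
L₀ — the stationary analogue of Lukkarinen–Spohn's t < t₀) → SlabContinuation (all L: a priori
bounds, or adding/doubling of slabs in the invariant-imbedding sense) → KineticSlabLimit.
SubkineticBallisticWindow ⇐ HarmonicLimitAtFixedLength → SecularControl (order-by-order N-growth of
the coupling expansion of D_N: no resistance at order ε, resistance ≍ ε²N) →
SubkineticBallisticWindow. k ≤ 3, depth 1 each; nothing filed now.

KILL CRITERIA. ¬KineticSlabLimit closes the route (close --reason refuted:KineticSlabLimit): e.g.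
the per-bond conductance on the diagonal tends to 0 (resistance already at scale ε⁻¹, or
localisation) or fails to converge. ¬SubkineticBallisticWindow (resistance below the kinetic length)
refutes the diagonal scaling itself — close, and hand the witness to card
onset-of-resistance-secular-series. ¬MilneContactLaw with KineticSlabLimit standing forces a pivot,
not a close: an anomalous kinetic slab (1/Γ(L) − L/c unbounded, e.g. a log L from grazing modes, or
c = 0 from an odd collisional invariant at a special ω₂) is restated with the measured law (route
edit --restate MilneContactLaw); ¬NoOddCollisionalInvariant at isolated ω₂ restricts the parameter
range. FouriersLaw proved elsewhere does not moot the route (its content — contact resistance and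
the crossover function — is finer than the conjunct) but demotes it to dormant.

NOT DECOMPOSED YET. The identification half of KineticSlabLimit and the kinetic-side objects (C_lin,
slab BVP, Milne lengths) wait for the definition requests; the two-fluid bookkeeping (κ_BLR = L_ee
versus the open-circuit combination) and KineticConstantsAgree (c = lim_{ε→0} ε²κ_GK(1; εa, εb):
consistency with route FourierGreenKubo's ThermodynamicLimit 0742 and with route KineticCorner's
constant); the small-L slope Γ(L) = c_∞ − σL + o(L) and its match σ ↔ the secular coefficient of the
onset card; rates (O(1/L) in the Ohm clause, exponential versus power corrections); the ω₂-ladder of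
higher resonances m²/(m+1) — all layer 2 or later. Deliberately NOT in the route: any uniformity of
the kinetic approximation in L at fixed ε (the exchange lim_L lim_ε ↔ lim_ε lim_N that would turn
X_K into low-temperature two-sided bounds on D_N) — the catalogued wall; a separate thesis if ever.

CHEAPEST FALSIFIER. (1) DONE by the planner: the wall law's checkable core — fluxLimit ω₂ γ =
(γ/π)∫_0^π sin²k/(2(1+γ²)(1−cos k)+γ²ω₂) dk = Landauer integral with albedo α_γ — agrees to 1e−14 at
(ω₂,γ) ∈ {(1,1),(0.5,2),(2,0.3),(0.1,1),(4,5),(0.01,0.1)} (local quadrature); a mismatch would have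
killed the wall dictionary. (2) For refuters, one NEMD kit job: pinnedChain at T = 1, (a,b) = (1,1),
ω₂ = γ = 1, ε ∈ {0.35, 0.25, 0.18}, N ∈ {8,…,512}: plot ε⁻²(N−1)/D_N against L = Nε² — the three
curves must collapse onto one function 1/Γ(L), affine at large L with POSITIVE intercept ρ and value
1/fluxLimit 1 1 = 8 as L → 0⁺; collapse in another variable (e.g. Nε) or a vanishing/negative
intercept kills the line cheaply. (3) Numerically scan the 2↔2 resonant set of ω² = ω₂ + 4sin²(k/2)
for an odd collisional invariant at ω₂ ∈ {0.5, 1, 2, 8} (least squares on a trigonometric basis): a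
non-trivial odd kernel vector makes c = 0 or ∞ there.

NUMBERS. c_∞ = fluxLimit ω₂ γ = γr/(2(1+γ²)), r = 1 + λ/2 − √(λ + λ²/4), λ = ω₂γ²/(1+γ²) (tree,
HarmonicChainFlux: fluxLimit 1 1 = 1/8, fluxLimit 0.1 1 = 1/5). Kinetic scales: mean free path and κ
∝ (λT)⁻² (AokiLukkarinenSpohn2006 (3.28): κ ≅ ω₀⁹(λT)⁻²δ²⟨ω⁻²g, L⁻¹ω⁻²g⟩, c(0) = 0.2756); number
relaxation on (λT)^{−2p}, p ≥ 2, with δ_c(4) = 1/2 so phonon number is a kinetic invariant for every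
ω₂ > 0 (HuveneersLukkarinen2020 pp. 2–3). Milne extrapolation length for isotropic one-speed
transport with a black wall: 0.7104 mean free paths (classical); grey walls enlarge it by about (2 −
α)/α (Majumdar1993: k_eff = k/(1 + 4Λ/3L)). Items at open: 10.

DEFINITION REQUESTS. Filed right after open (--kind definition, topic
Literature/MathematicalPhysics/KineticTheory, for MilneContactLaw): (D1)
LinearisedPhononCollisionOperator — the ALS/Spohn linearised 2↔2 collision operator of the pinned
band ω(k)² = ω₂ + 4 sin²(k/2) with quartic vertex a + b·Π_j(e^{ik_j} − 1), as a closed operator on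
L²(𝕋) (Spohn2006Phonon §4–5, AokiLukkarinenSpohn2006 (3.20)); (D2) KineticSlabConductance — the
conductance functional of the stationary slab problem v(k)∂_yW = C W on (0, L) with albedo
(partially absorbing, thermally emitting) wall data (BardosSantosSentis1984;
BasileKomorowskiOlla2019 for thermostat kernels); (D3) MilneExtrapolationLength — the asymptotic
constant of the half-space problem (BensoussanLionsPapanicolaou1979; LiLuSun2017). Cite-fact wanted
later: the diffusion-approximation / critical-size theorem of BardosSantosSentis1984 for gapped
linear transport in a slab.

Novelty: Searches (2026-08-15): `lit search --hybrid "Milne problem extrapolation length diffusion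
approximation linear transport slab critical size"` (12 held books: Dautray–Lions, Cercignani 1988,
Castor 2004, Bellman–Wing invariant imbedding — classical slab/Milne technology, no lattices); `lit
search --source zbmath` ×6 ("kinetic limit harmonic oscillators Langevin thermostat …": 1 hit,
KomorowskiOlla2020; "diffusion limit kinetic equation thermostatted interface":
BasileKomorowskiOlla2019 and arXiv:2209.14646; "phonon Boltzmann equation weakly anharmonic lattice
boundary", "stationary Boltzmann equation slab two thermostats conductance Milne", "heat conduction
thin film Boltzmann transport equation slab temperature jump": 0 hits; "kinetic limit stationary
nonequilibrium anharmonic": only BLLO 2009 self-consistent baths); `lit search --source crossref` ×7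
(found EspositoLebowitzMarra1994, EspositoEtAl2013, CaprinoPulvirenti1996 — stationary
kinetic/hydrodynamic limits in a slab for GASES; LiLuSun2017, AokiLinWu2020 — half-space/Milne
theory incl. two species; Majumdar1993 and thin-film phonon-BTE engineering papers
doi:10.1115/1.2944249, doi:10.1016/s0022-4073(02)00172-3); `lit galaxy search "phonon Boltzmann
equation" --star all` (16 rows: textbooks Parrott–Stuckes, Ferry; NEGF junction transport
cond-mat/0701164; no stationary anharmonic slab limit); `lit galaxy search "Milne problem" --star
all` (8 rows: LiLuSun half-space report, neutron and radiative transfer); `lit frontier  [refs: 10.1115/1.2944249, 10.1016/s0022-4073(02, 10.1016/j.jfa.2020.108764, 2209.14646, 2604.14056, 2310.13338, doi:10.1115/1.2944249, doi:10.1016/s0022-4073, doi:10.1016/j.jfa.2020.108764, KomorowskiOlla2020, BasileKomorowskiOlla2019, EspositoLebowitzMarra1994, EspositoEtAl2013, CaprinoPulvirenti1996, LiLuSun2017, AokiLinWu2020, Majumdar1993, KomorowskiEtAl2020, AokiLukkarinenSpohn2006]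

Barriers (technique_class: kinetic-slab-bvp, milne-boundary-layer, diagonal-scaling): - technique_class: kinetic-slab-bvp, milne-boundary-layer, diagonal-scaling
- Literature.Barriers.AtomisticToContinuum.LowTemperatureWeakAnharmonicity: the route IS the
barrier's listed evasion (resummation on the kinetic scale N ∼ (λT)⁻², t ∼ (λT)⁻²): every statement
is a limit ε → 0 along the diagonal, constants are organised by ε and never claimed uniform in T;
conceded openly that this yields a rung (X_K), not FouriersLawFor at fixed couplings.
- Literature.Barriers.AtomisticToContinuum.HarmonicChainBallisticFlux: USED, not fought — the
harmonic end point is the L → 0⁺ anchor (fluxLimit, tendsto_fluxCoeff, both proved); every crux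
degenerates correctly at ε = 0 (there Γ ≡ c_∞ and MilneContactLaw is false), so no step is
anharmonicity-free: KineticSlabLimit and MilneContactLaw carry the collisions,
SubkineticBallisticWindow says exactly where they do not yet act.
- Literature.Barriers.AtomisticToContinuum.HasBoundedResponse: not evaded for the conjunct and not
claimed — Γ ≍ 1/L is bounded response at the KINETIC level only; the cruxes need N-uniform NESS
control on windows N ≲ L·ε⁻², i.e. they leave the fixed-N technique class the barrier describes, but
deliver nothing at fixed ε as N → ∞ (the exchange of limits is named in § Not decomposed yet as the
wall).
- Literature.Barriers.AtomisticToContinuum.LukkarinenSpohn2008_lemma41: the FPU anomaly needs an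
acoustic band with collision frequency ∼ |k|^(5/3); the conjunct's band is gapped (ω ≥ √ω₂ > 0, δ <
1/2) with non-degener

History (route lifecycle, newest last):
- 2026-08-15T12:32:14Z · CLOSED superseded — superseded:route-AtomisticToContinuum-KineticSlabContacts (planner-plancard-AtomisticToContinuum-Fourier-3b36f0d1-0)

sub-problem: FouriersLaw · status: closed(superseded) · opened planner-plancard-AtomisticToContinuum-Fourier-3b36f0d1-0 2026-08-15T11:46:39Z · rev 0 · ledger route-AtomisticToContinuum-KineticSlab
GENERATED by the gate from the ledger (D-0016/17). Provers cite these decls: `theorem foo : Summit.AtomisticToContinuum.FouriersLaw.Theses.KineticSlab.<Decl> := …` in Summits/AtomisticToContinuum/FouriersLaw/Theorems/<Name>.lean.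
-/

namespace Summit.AtomisticToContinuum.FouriersLaw.Theses.KineticSlab

open scoped BigOperators Topology Manifold Classical MeasureTheory ProbabilityTheory Matrix InnerProductSpace ComplexConjugate ContinuousMap
open Filter Set Function TopologicalSpace MeasureTheory

attribute [summit_statement] _root_.FouriersLaw

/-- item stmt-AtomisticToContinuum-6438 · target · rank 0 · closed · moot by None · by planner
why it might fail: Inherits the cruxes: no stationary anharmonic kinetic limit exists in print (KineticSlabLimit); grazing band-edge modes or an odd collisional invariant could spoil the affine resistance law or c > 0 (MilneContactLaw); resistance could set in below the kinetic length (SubkineticBallisticWindow).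
sources: BonettoLebowitzReyBellet2000, AokiLukkarinenSpohn2006, KomorowskiOlla2020, BardosSantosSentis1984, RoyDhar2008
[target] X_K as in § Thesis: for ω₂, a, b, γ > 0, assuming HasUniqueSteadyStates and finite T = 1
response for every P_ε (ε > 0), there are Γ : ℝ → ℝ, c > 0, ρ > 0 with: for every L > 0, Γ(L) > 0
and every diagonal response function D (D ε N = the T = 1 response coefficient of P_ε at length N,
for some steady-state family) satisfies D ε ⌈L/ε²⌉/(⌈L/ε²⌉ − 1) → Γ(L) as ε → 0⁺; Γ(L) → fluxLimit
ω₂ γ as L → 0⁺; and 1/Γ(L) − L/c → ρ as L → ∞. -/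
@[route_item "route-AtomisticToContinuum-KineticSlab"]
def KineticFourierLaw : Prop :=
  ∀ ω₂ a b γ : ℝ, 0 < ω₂ → 0 < a → 0 < b → 0 < γ → (∀ ε : ℝ, 0 < ε → (Literature.MathematicalPhysics.KineticTheory.HeatConduction.pinnedChain ω₂ (ε * a) (ε * b) γ).HasUniqueSteadyStates) → (∀ ε : ℝ, 0 < ε → ∀ μ : (N : ℕ) → ℝ → ℝ → MeasureTheory.Measure (Literature.MathematicalPhysics.KineticTheory.HeatConduction.PhaseSpace N), (∀ (N : ℕ) (T_L T_R : ℝ), 0 < T_L → 0 < T_R → (Literature.MathematicalPhysics.KineticTheory.HeatConduction.pinnedChain ω₂ (ε * a) (ε * b) γ).IsSteadyState N T_L T_R (μ N T_L T_R)) → ∀ N : ℕ, ∃ d : ℝ, Filter.Tendsto (fun δ : ℝ => (Literature.MathematicalPhysics.KineticTheory.HeatConduction.pinnedChain ω₂ (ε * a) (ε * b) γ).totalCurrent (μ N (1 + δ / 2) (1 - δ / 2)) / δ) (nhdsWithin 0 {(0 : ℝ)}ᶜ) (nhds (d))) → ∃ (Γ : ℝ → ℝ) (c ρ : ℝ), 0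 < c ∧ 0 < ρ ∧ (∀ L : ℝ, 0 < L → 0 < Γ L ∧ ∀ D : ℝ → ℕ → ℝ, (∀ ε : ℝ, 0 < ε → ∃ μ : (N : ℕ) → ℝ → ℝ → MeasureTheory.Measure (Literature.MathematicalPhysics.KineticTheory.HeatConduction.PhaseSpace N), (∀ (N : ℕ) (T_L T_R : ℝ), 0 < T_L → 0 < T_R → (Literature.MathematicalPhysics.KineticTheory.HeatConduction.pinnedChain ω₂ (ε * a) (ε * b) γ).IsSteadyState N T_L T_R (μ N T_L T_R)) ∧ ∀ N : ℕ, Filter.Tendsto (fun δ : ℝ => (Literature.MathematicalPhysics.KineticTheory.HeatConduction.pinnedChain ω₂ (ε * a) (ε * b) γ).totalCurrent (μ N (1 + δ / 2) (1 - δ / 2)) / δ) (nhdsWithin 0 {(0 : ℝ)}ᶜ) (nhds (D ε N))) → Filter.Tendsto (fun ε : ℝ => D ε ⌈L / ε ^ 2⌉₊ / (((⌈L / ε ^ 2⌉₊ : ℕ) : ℝ) - 1)) (nhdsWithin 0 (Set.Ioi 0)) (nhds (Γ L))) ∧ Filter.Tendsto Γ (nhdsWithin 0 (Set.Ioi 0))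 (nhds (Literature.MathematicalPhysics.KineticTheory.HeatConduction.fluxLimit ω₂ γ)) ∧ Filter.Tendsto (fun L : ℝ => 1 / Γ L - L / c) Filter.atTop (nhds ρ)

/-- item stmt-AtomisticToContinuum-6439 · crux · rank 2 · closed · moot by None · by planner
why it might fail: No stationary kinetic limit is proved for any anharmonic lattice: needs NESS cumulant control uniformly in N ≍ ε⁻² (boundary-driven Lukkarinen–Spohn/Deng–Hani expansion); LS2010 reach kinetic times < t₀ only and a phonon lives ~L kinetic units in the slab: large L may defeat convergent expansions.
sources: AokiLukkarinenSpohn2006, Spohn2006Phonon, LukkarinenSpohn2010, KomorowskiOlla2020, KomorowskiEtAl2020, CaprinoPulvirenti1996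
[crux] (card item KineticSlabLimit, existence half; the identification is its informal content) for
ω₂, a, b, γ > 0 and unique weak steady states of every P_ε there is Γ with, for every L > 0: Γ(L) >
0 and, for every diagonal response function D, D ε ⌈L/ε²⌉/(⌈L/ε²⌉ − 1) → Γ(L) as ε → 0⁺. Intended
proof and meaning: on the diagonal the NESS Wigner function of P_ε converges to the solution of the
stationary linearised phonon-Boltzmann slab v(k)∂_yW = C_lin W on (0, L) × 𝕋 with albedo wall
conditions (a phonon hitting a Langevin end is absorbed with probability α_γ(k), reflected k ↦ −k
otherwise; the wall emits at its bath temperature with emissivity α_γ(k)) — the END-thermostat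
version of the Komorowski–Olla interface law — and Γ(L) is that slab's conductance; C_lin = ALS's
2↔2 operator of the pinned band ω(k)² = ω₂ + 4 sin²(k/2) with quartic vertex a + b·Π_j(e^{ik_j} −
1), conserving energy AND phonon number (δ = 1/(ω₂+2) < 1/2 for every ω₂ > 0). [difficulty:
open-problem] -/
@[route_item "route-AtomisticToContinuum-KineticSlab"]
def KineticSlabLimit : Prop :=
  ∀ ω₂ a b γ : ℝ, 0 < ω₂ → 0 < a → 0 < b → 0 < γ → (∀ ε : ℝ, 0 < ε → (Literature.MathematicalPhysics.KineticTheory.HeatConduction.pinnedChain ω₂ (ε * a) (ε * b) γ).HasUniqueSteadyStates) → ∃ Γ : ℝ → ℝ, ∀ L : ℝ, 0 < L → 0 < Γ L ∧ ∀ D : ℝ → ℕ → ℝ, (∀ ε : ℝ, 0 < ε → ∃ μ : (N : ℕ) → ℝ → ℝ → MeasureTheory.Measure (Literature.MathematicalPhysics.KineticTheory.HeatConduction.PhaseSpace N), (∀ (N : ℕ) (T_L T_R : ℝ), 0 < T_L → 0 < T_R → (Literature.MathematicalPhysics.KineticTheory.HeatConduction.pinnedChain ω₂ (ε * a) (ε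 * b) γ).IsSteadyState N T_L T_R (μ N T_L T_R)) ∧ ∀ N : ℕ, Filter.Tendsto (fun δ : ℝ => (Literature.MathematicalPhysics.KineticTheory.HeatConduction.pinnedChain ω₂ (ε * a) (ε * b) γ).totalCurrent (μ N (1 + δ / 2) (1 - δ / 2)) / δ) (nhdsWithin 0 {(0 : ℝ)}ᶜ) (nhds (D ε N))) → Filter.Tendsto (fun ε : ℝ => D ε ⌈L / ε ^ 2⌉₊ / (((⌈L / ε ^ 2⌉₊ : ℕ) : ℝ) - 1)) (nhdsWithin 0 (Set.Ioi 0)) (nhds (Γ L))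

/-- item stmt-AtomisticToContinuum-6440 · crux · rank 3 · closed · moot by None · by planner
why it might fail: Milne theory is printed for gapped one-speed operators; C_lin has unbounded collision frequency, slow band-edge modes (v→0) and kernel {1,ω}: extrapolation lengths may diverge or corrections be O(log L); c>0 needs NoOddCollisionalInvariant (ALS06 §4: no proof); ρ>0 needs a two-fluid jump matrix ≥ 0.
sources: BardosSantosSentis1984, BensoussanLionsPapanicolaou1979, LiLuSun2017, AokiLinWu2020, BasileKomorowskiOlla2019, HuveneersLukkarinen2020
[crux] (card items SlabDiffusionApproximation and TwoFluid, chain-side form) for ω₂, a, b, γ > 0,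
unique weak steady states and finite T = 1 responses of every P_ε: every function Γ that is the
diagonal limit of the per-bond conductance (hypothesis copied from KineticSlabLimit) obeys Ohm's law
with a contact resistance: ∃ c > 0, ρ > 0 with 1/Γ(L) − L/c → ρ as L → ∞. Content: identification of
Γ with the slab conductance, then the diffusion approximation of the slab BVP with Milne boundary
layers at the two grey walls. Because 3↔1 processes are non-resonant for every ω₂ > 0
(HuveneersLukkarinen2020), ker C_lin ⊇ {1, ω} and the slab is a TWO-FLUID conductor (energy + phonon
number); the walls pin the phonon chemical potential to 0 and the 2×2 Onsager algebra gives 1/Γ =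
L/𝕃_ee + (𝕃𝔹𝕃)_ee/𝕃_ee² + O(1/L) with 𝔹 the sum of the two Milne jump matrices — so c = 𝕃_ee (the
Green–Kubo energy coefficient: κ_BLR = L_ee, not the open-circuit L_ee − L_en²/L_nn) and ρ = two
extrapolation lengths over c. [deps: KineticSlabLimit] [difficulty: L] -/
@[route_item "route-AtomisticToContinuum-KineticSlab"]
def MilneContactLaw : Prop :=
  ∀ ω₂ a b γ : ℝ, 0 < ω₂ → 0 < a → 0 < b → 0 < γ → (∀ ε : ℝ, 0 < ε → (Literature.MathematicalPhysics.KineticTheory.HeatConduction.pinnedChain ω₂ (ε * a) (ε * b) γ).HasUniqueSteadyStates) → (∀ ε : ℝ, 0 < ε → ∀ μ : (N : ℕ) → ℝ → ℝ → MeasureTheory.Measure (Literature.MathematicalPhysics.KineticTheory.HeatConduction.PhaseSpace N), (∀ (N : ℕ) (T_L T_R : ℝ), 0 < T_L → 0 < T_R → (Literature.MathematicalPhysics.KineticTheory.HeatConduction.pinnedChain ω₂ (ε * a) (ε * b) γ).IsSteadyState N T_L T_R (μ N T_L T_R)) → ∀ N : ℕ, ∃ d : ℝ, Filter.Tendsto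 (fun δ : ℝ => (Literature.MathematicalPhysics.KineticTheory.HeatConduction.pinnedChain ω₂ (ε * a) (ε * b) γ).totalCurrent (μ N (1 + δ / 2) (1 - δ / 2)) / δ) (nhdsWithin 0 {(0 : ℝ)}ᶜ) (nhds (d))) → ∀ Γ : ℝ → ℝ, (∀ L : ℝ, 0 < L → ∀ D : ℝ → ℕ → ℝ, (∀ ε : ℝ, 0 < ε → ∃ μ : (N : ℕ) → ℝ → ℝ → MeasureTheory.Measure (Literature.MathematicalPhysics.KineticTheory.HeatConduction.PhaseSpace N), (∀ (N : ℕ) (T_L T_R : ℝ), 0 < T_L → 0 < T_R → (Literature.MathematicalPhysics.KineticTheory.HeatConduction.pinnedChain ω₂ (ε * a) (ε * b) γ).IsSteadyState N T_L T_R (μ N T_L T_R)) ∧ ∀ N : ℕ, Filter.Tendsto (fun δ : ℝ => (Literature.MathematicalPhysics.KineticTheory.HeatConduction.pinnedChain ω₂ (ε * a) (ε * b) γ).totalCurrent (μ N (1 + δ / 2) (1 - δ / 2)) / δ) (nhdsWithin 0 {(0 : ℝ)}ᶜ) (nhds (D ε N))) → Filter.Tendsto (fun ε : ℝ => D ε ⌈L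 / ε ^ 2⌉₊ / (((⌈L / ε ^ 2⌉₊ : ℕ) : ℝ) - 1)) (nhdsWithin 0 (Set.Ioi 0)) (nhds (Γ L))) → ∃ c ρ : ℝ, 0 < c ∧ 0 < ρ ∧ Filter.Tendsto (fun L : ℝ => 1 / Γ L - L / c) Filter.atTop (nhds ρ)

/-- item stmt-AtomisticToContinuum-6441 · crux · rank 4 · closed · moot by None · by planner
why it might fail: Resistance might set in before the kinetic length: order-ε^k NESS corrections must be controlled uniformly for N ≪ ε⁻² against the N⁻³ gap of the open harmonic chain (Becker–Menegaki) and an only-asymptotic (non-analytic at ε=0) coupling expansion; Lefevere–Schenkel: order one only.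
sources: LefevereSchenkel2004, BeckerMenegaki2022, RoyDhar2008, Nakazawa1970, HairerMajda2009, AokiLukkarinenSpohn2006
[crux] (card prediction p4 = the matching condition with card onset-of-resistance-secular-series)
below the kinetic length the anharmonic chain conducts like the harmonic one: for ω₂, a, b, γ > 0,
unique weak steady states of every P_ε, every diagonal response function D and all sequences ε_n →
0⁺, N_n → ∞ with N_n·ε_n² → 0: D ε_n N_n/(N_n − 1) → fluxLimit ω₂ γ = c_∞ (the RLL/Nakazawa
ballistic constant, PROVED: tendsto_fluxCoeff, fluxLimit_pos). With KineticSlabLimit it yields Γ(0⁺)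
= c_∞, the Landauer end of the slab; its expected sharpening G_N = c_N(1 + O(ε) − σε²N + …) is the
matching condition with the secular series of the onset card. [difficulty: L] -/
@[route_item "route-AtomisticToContinuum-KineticSlab"]
def SubkineticBallisticWindow : Prop :=
  ∀ ω₂ a b γ : ℝ, 0 < ω₂ → 0 < a → 0 < b → 0 < γ → (∀ ε : ℝ, 0 < ε → (Literature.MathematicalPhysics.KineticTheory.HeatConduction.pinnedChain ω₂ (ε * a) (ε * b) γ).HasUniqueSteadyStates) → ∀ D : ℝ → ℕ → ℝ, (∀ ε : ℝ, 0 < ε → ∃ μ : (N : ℕ) → ℝ → ℝ → MeasureTheory.Measure (Literature.MathematicalPhysics.KineticTheory.HeatConduction.PhaseSpace N), (∀ (N : ℕ) (T_L T_R : ℝ), 0 < T_L → 0 < T_R → (Literature.MathematicalPhysics.KineticTheory.HeatConduction.pinnedChain ω₂ (ε * a) (ε * b) γ).IsSteadyState N T_L T_R (μ N T_L T_R)) ∧ ∀ N : ℕ, Filter.Tendsto (fun δ : ℝ => (Literature.MathematicalPhysics.KineticTheory.HeatConduction.pinnedChain ω₂ (ε * a) (ε * b) γ).totalCurrent (μ N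 (1 + δ / 2) (1 - δ / 2)) / δ) (nhdsWithin 0 {(0 : ℝ)}ᶜ) (nhds (D ε N))) → ∀ (e : ℕ → ℝ) (M : ℕ → ℕ), (∀ n : ℕ, 0 < e n) → Filter.Tendsto e Filter.atTop (nhds 0) → Filter.Tendsto M Filter.atTop Filter.atTop → Filter.Tendsto (fun n : ℕ => (M n : ℝ) * e n ^ 2) Filter.atTop (nhds 0) → Filter.Tendsto (fun n : ℕ => D (e n) (M n) / ((M n : ℝ) - 1)) Filter.atTop (nhds (Literature.MathematicalPhysics.KineticTheory.HeatConduction.fluxLimit ω₂ γ))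

/-- item stmt-AtomisticToContinuum-0717 · support · rank 9 · closed · proved by Summit.AtomisticToContinuum.FouriersLaw.Theorems.FourierGreenKubo.finiteResponseOfUnique_holds (prover) · by planner
sources: ReyBellet2003, HairerMajda2009
CONDITIONAL FORM OF 0705 (supersedes it as the prover target; refuters pool-5/g3-0: 0705 stand-alone
quantifies over EVERY steady-state family and is false-prone if weak steady states were non-unique):
assuming UNIQUENESS of weak steady states (IsSteadyState class) for pinnedChain at all N, T_L, T_R >
0, the finite-N linear-response limit D_N(T) = lim_{δ→0, δ≠0} totalCurrent(μ_{N,T+δ/2,T−δ/2})/δ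
exists for every T > 0 and N. Content: differentiability at equilibrium of NESS expectations of the
polynomial currents in the bath temperatures (ReyBellet2003 arXiv:math-ph/0303021 Rem 4.4 (51)–(56)
finite-volume Green–Kubo; HairerMajda2009 arXiv:0909.4313 Thm 2.3 framework — their SDE Thm 4.4
Assumption 5 fails here, so verify Assumptions 1–3 via CEHR2018 (2.5)/Carmona2007 Thm 1.1(iv)
weighted spectral gap). N = 0, 1: totalCurrent ≡ 0, D = 0. Together with 0706 gives 0705. -/
@[route_item "route-AtomisticToContinuum-KineticSlab"]
def FiniteResponseOfUnique : Prop :=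
  ∀ ω₂ lam β γ : ℝ, 0 < ω₂ → 0 < lam → 0 < β → 0 < γ → (∀ (N : ℕ) (T_L T_R : ℝ), 0 < T_L → 0 < T_R → ∀ μ ν : MeasureTheory.Measure (Literature.MathematicalPhysics.KineticTheory.HeatConduction.PhaseSpace N), (Literature.MathematicalPhysics.KineticTheory.HeatConduction.pinnedChain ω₂ lam β γ).IsSteadyState N T_L T_R μ → (Literature.MathematicalPhysics.KineticTheory.HeatConduction.pinnedChain ω₂ lam β γ).IsSteadyState N T_L T_R ν → μ = ν) → ∀ μ : (N : ℕ) → ℝ → ℝ → MeasureTheory.Measure (Literature.MathematicalPhysics.KineticTheory.HeatConduction.PhaseSpace N), (∀ (N : ℕ) (T_L T_R : ℝ), 0 < T_L → 0 < T_R → (Literature.MathematicalPhysics.KineticTheory.HeatConduction.pinnedChain ω₂ lam β γ).IsSteadyState N T_L T_R (μ N T_L T_R)) → ∀ T : ℝ, 0 < T → ∀ N : ℕ, ∃ D : ℝ, Filter.Tendsto (fun δ : ℝ => (Literature.MathematicalPhysics.KineticTheory.HeatConduction.pinnedChain ω₂ lam β γ).totalCurrent (μ N (T + δ / 2) (T -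 δ / 2)) / δ) (nhdsWithin 0 {(0 : ℝ)}ᶜ) (nhds D)

/-- `FiniteResponseOfUnique` holds: proved by `Summit.AtomisticToContinuum.FouriersLaw.Theorems.FourierGreenKubo.finiteResponseOfUnique_holds`. -/
theorem FiniteResponseOfUnique_holds : FiniteResponseOfUnique := _root_.Summit.AtomisticToContinuum.FouriersLaw.Theorems.FourierGreenKubo.finiteResponseOfUnique_holds

/-- item stmt-AtomisticToContinuum-3432 · support · rank 9 · closed · proved by Summit.AtomisticToContinuum.FouriersLaw.Theorems.KineticCorner.noOddCollisionalInvariant_kineticSlabContacts @ 375ff106628f (prover) · by planner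
sources: AokiLukkarinenSpohn2006, Spohn2006, LukkarinenSpohn2008
[crux] NO ODD COLLISIONAL INVARIANT ON THE PINNED BAND (d = 1; card crux CollisionKernelPositivity,
parity half, typed as real analysis). For ω(k) = √(ω₂ + 2(1 − cos k)), ω₂ > 0: every continuous
2π-periodic ODD ψ with ψ(k₁) + ψ(k₂) = ψ(k₃) + ψ(k₁+k₂−k₃) whenever ω(k₁) + ω(k₂) = ω(k₃) +
ω(k₁+k₂−k₃) (the 2↔2 energy–momentum resonant set: label exchanges ∪ the non-perturbative branch k₂
= h(k₁;k₃), ALS06 (4.2)–(4.7)) vanishes identically. With the even invariants 1, ω this is the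
parity sector of 'ker L = span{1, ω}' — ALS06 §4 (4.9)–(4.10): 'We expect that there are no further
solutions, but no proof is available'; PROVED only for d ≥ 2 (Spohn2006, Proposition: the Hessian
argument needs d ≥ 2) and for the acoustic FPU band (LukkarinenSpohn2008 Thm 2.2). Role in the
route: the energy-current weight v ∝ ω′ω-type is odd, so v ⊥ ker L ⟺ no odd invariant — the input
that makes ∫₀^∞ K = ⟨v, L⁻¹v⟩ > 0 and finite modulo coercivity (KineticLimit's positivity clause),
and the kinetic shadow of the Mazur barrier (an odd invariant = a kinetic-level Drude weight ⇒ K(τ)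
↛ 0 ⇒ (lamT)²κ → ∞ at that ω₂; Zakharov–Schulman: extra invariant ⇔ degenerative dispersion law).
Degeneration to watch: as ω₂ -/
@[route_item "route-AtomisticToContinuum-KineticSlab"]
def NoOddCollisionalInvariant : Prop :=
  ∀ ω₂ : ℝ, 0 < ω₂ → ∀ ψ : ℝ → ℝ, Continuous ψ → Function.Periodic ψ (2 * Real.pi) → (∀ k : ℝ, ψ (-k) = -ψ k) → (∀ k₁ k₂ k₃ : ℝ, Real.sqrt (ω₂ + 2 * (1 - Real.cos k₁)) + Real.sqrt (ω₂ + 2 * (1 - Real.cos k₂)) = Real.sqrt (ω₂ + 2 * (1 - Real.cos k₃)) + Real.sqrt (ω₂ + 2 * (1 - Real.cos (k₁ + k₂ - k₃))) → ψ k₁ + ψ k₂ = ψ k₃ + ψ (k₁ + k₂ - k₃)) → ∀ k : ℝ, ψ k = 0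

/-- item stmt-AtomisticToContinuum-6442 · support · rank 9 · closed · moot by None · by planner
sources: RiederLebowitzLieb1967, Nakazawa1970, RoyDhar2008, Dhar2008, KomorowskiOlla2020
[support] (card item EndThermostatAlbedo, its checkable core) the PROVED RLL/Nakazawa constant is
the incoherent two-grey-wall Landauer integral with the END-THERMOSTAT ALBEDO: fluxLimit ω₂ γ =
(1/2π)∫_0^π v(k)·α_γ(k)/(2 − α_γ(k)) dk with ω(k) = √(ω₂ + 2(1 − cos k)), v = sin k/ω, α_γ(k) = 1 −
|ρ_γ(k)|² = 4γω sin k/((1 − cos k)² + (sin k + γω)²) the absorption probability of a band phonon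
hitting the Langevin end site (impedance mismatch of the Ornstein–Uhlenbeck end; α/(2 − α) =
phase-averaged Fabry–Pérot transmission of two identical walls), which simplifies to the typed
closed form fluxLimit ω₂ γ = (γ/π)∫_0^π sin²k/(2(1+γ²)(1 − cos k) + γ²ω₂) dk. Verified numerically
to 1e−14 at six (ω₂, γ) by the planner; an elementary integral (∫_0^π sin²k/(A − B cos k) dk = π(A −
√(A² − B²))/B²) against rootR. [difficulty: provable-now] -/
@[route_item "route-AtomisticToContinuum-KineticSlab"]
def LandauerAlbedoIdentity : Prop :=
  ∀ ω₂ γ : ℝ, 0 < ω₂ → 0 < γ → Literature.MathematicalPhysics.KineticTheory.HeatConduction.fluxLimit ω₂ γ = γ / Real.pi * ∫ k in (0 : ℝ)..Real.pi, Real.sin k ^ 2 / (2 * (1 + γ ^ 2) * (1 - Real.cos k) + γ ^ 2 * ω₂)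

/-- item stmt-AtomisticToContinuum-6443 · support · rank 9 · closed · moot by None · by planner
sources: CuneoEckmannHairerReyBellet2018, HairerMajda2009, ReyBellet2003, RoyDhar2008, LefevereSchenkel2004
[support] (base case of SubkineticBallisticWindow at FIXED N; calibrates the normalisation D_N =
(N−1)c_N of HarmonicChainBallisticFlux.ballisticLaw) for ω₂, a, b, γ > 0, unique weak steady states
of every P_ε and every diagonal response function D: for each N ≥ 2, D ε N → (N − 1)·fluxCoeff ω₂ γ
N as ε → 0⁺ (continuity of BLR's finite-N response at the harmonic point). Fixed-N technology:
tightness of the NESS of P_ε uniformly in ε ∈ (0, 1] (Lyapunov control à la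
Cuneo–Eckmann–Hairer–Rey-Bellet with ε-uniform constants — the one non-routine point, since the
quartic confinement degenerates), weak convergence to the unique Gaussian RLL state, and convergence
of the δ-derivative via the finite-N Kubo formula. [difficulty: M] -/
@[route_item "route-AtomisticToContinuum-KineticSlab"]
def HarmonicLimitAtFixedLength : Prop :=
  ∀ ω₂ a b γ : ℝ, 0 < ω₂ → 0 < a → 0 < b → 0 < γ → (∀ ε : ℝ, 0 < ε → (Literature.MathematicalPhysics.KineticTheory.HeatConduction.pinnedChain ω₂ (ε * a) (ε * b) γ).HasUniqueSteadyStates) → ∀ D : ℝ → ℕ → ℝ, (∀ ε : ℝ, 0 < ε → ∃ μ : (N : ℕ) → ℝ → ℝ → MeasureTheory.Measure (Literature.MathematicalPhysics.KineticTheory.HeatConduction.PhaseSpace N), (∀ (N : ℕ) (T_L T_R : ℝ), 0 < T_L → 0 < T_R → (Literature.MathematicalPhysics.KineticTheory.HeatConduction.pinnedChain ω₂ (ε * a) (ε * b) γ).IsSteadyState N T_L T_R (μ N T_L T_R)) ∧ ∀ N : ℕ, Filter.Tendsto (fun δ : ℝ => (Literature.MathematicalPhysics.KineticTheory.HeatConduction.pinnedChain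 ω₂ (ε * a) (ε * b) γ).totalCurrent (μ N (1 + δ / 2) (1 - δ / 2)) / δ) (nhdsWithin 0 {(0 : ℝ)}ᶜ) (nhds (D ε N))) → ∀ N : ℕ, 2 ≤ N → Filter.Tendsto (fun ε : ℝ => D ε N) (nhdsWithin 0 (Set.Ioi 0)) (nhds ((((N : ℕ) : ℝ) - 1) * Literature.MathematicalPhysics.KineticTheory.HeatConduction.fluxCoeff ω₂ γ N))

/-- item stmt-AtomisticToContinuum-6444 · assembly · rank 1 · closed · moot by None · by planner
sources: BonettoLebowitzReyBellet2000, AokiLukkarinenSpohn2006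
[assembly] KineticSlabLimit → MilneContactLaw → SubkineticBallisticWindow → KineticFourierLaw. -/
@[route_item "route-AtomisticToContinuum-KineticSlab"]
def Assembly : Prop :=
  KineticSlabLimit → MilneContactLaw → SubkineticBallisticWindow → KineticFourierLaw

end Summit.AtomisticToContinuum.FouriersLaw.Theses.KineticSlab
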